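import Summits.HodgeConjecture.HodgeConjecture.Theses.LinearSystemTorelli
import Literature.AlgebraicGeometry.HodgeTheory.HardLefschetzNFold
import Literature.AlgebraicGeometry.HodgeTheory.TopDegreeClasses
import Literature.AlgebraicGeometry.HodgeTheory.HardLefschetzNFoldHolds

/-!
# Route LinearSystemTorelli — `HardLefschetzReduction` (support item stmt-HodgeConjecture-1084)

The item: for `n < 2p`, on a smooth projective complex `n`-fold `X`, the Hodge conjecture in
codimension `n - p` implies the Hodge conjecture in codimension `p` (Voisin I, Thm. 6.25 / Rem. 6.27 /
§7.1.2: `L^{2p-n} : H^{2n-2p}(X, ℚ) ≅ H^{2p}(X, ℚ)` is an isomorphism of Hodge structures, and cup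
product with powers of the hyperplane class preserves algebraic classes; Kerr–Pearlstein 2011 §3.1).

What is proved here (helpers `--supports stmt-HodgeConjecture-1084`):

* `linearSystemTorelli_mem_algebraicClasses_of_dim_le` — **the range `p ≥ n` is unconditional**:
  for `p = n ≥ 1` every class of top degree is algebraic (`mem_algebraicClasses_of_degree_top`,
  `H²ⁿ = ℚ·[pt]`), for `p = n = 0` `algebraicClasses X 0 = ⊤`, and for `p > n` there is no non-zero
  `(p,p)`-class (`IsOfHodgeType.eq_zero_pp_of_lt`).  In particular the item holds outright for curves
  and surfaces (`n ≤ 2` and `n < 2p` force `n ≤ p`).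
* `linearSystemTorelli_hardLefschetzReduction_of_nonempty_hardLefschetzNFold` — **the item from the
  named fact `nonempty_hardLefschetzNFold n X` in dimensions `n ≥ 3` only** (the hard Lefschetz datum
  of the hyperplane class on the summit carriers, `Literature/…/HardLefschetzNFold`): the remaining
  range `n/2 < p < n` is `HardLefschetzNFold.mem_algebraicClasses_of_lt`.

So the item is EXACTLY the fact `∀ n ≥ 3, ∀ X, nonempty_hardLefschetzNFold n X` away from the trivial
range; the fact is not yet discharged in the tree (hard Lefschetz itself, hodge.S14, is:
`Motives.hasHardLefschetzProperty_kaehlerClass_holds`; what is missing is the rationality of the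
hyperplane class `[ω_FS|_X] = c₁(𝒪_X(1))` and its vanishing off every hyperplane section, see
`HardLefschetzNFoldOfPolarizationClass`, `LefschetzOperatorAlgebraicClasses`).
-/

noncomputable section

-- `Summit.HodgeConjecture.HodgeConjecture.Theorems` is the mandated namespace (single-problem summit:
-- Problem = Summit), which `linter.dupNamespace` flags on every declaration; the lakefile turns the
-- linter off tree-wide (weak option), restated here so stand-alone elaboration is warning-free too.
set_option linter.dupNamespace false

namespace Summit.HodgeConjecture.HodgeConjecture.Theorems

open Literature.AlgebraicGeometry.HodgeTheory Literature.AlgebraicGeometry.Motives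

/-- **The trivial range of the hard-Lefschetz reduction, unconditionally**: on a smooth projective
complex `n`-fold, every class of Hodge type `(p,p)` in `H²ᵖ(X(ℂ); ℂ)` with `p ≥ n` is algebraic —
`p = n ≥ 1`: `H²ⁿ(X(ℂ); ℂ) = Nⁿ H²ⁿ` (every top-degree class dies off a point,
`mem_algebraicClasses_of_degree_top`); `p = n = 0`: `algebraicClasses X 0 = ⊤`
(`hodgeConjectureFor_codim_zero`); `p > n`: the class is `0` (`IsOfHodgeType.eq_zero_pp_of_lt`).
No rationality hypothesis is needed. [cite: VoisinHodgeII2003, §10.2.3 proof of Prop. 10.26]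
[cite: VoisinHodgeI2002, §2.3.1 and §11.1.2] -/
theorem linearSystemTorelli_mem_algebraicClasses_of_dim_le {n p : ℕ} {X : SchemeOver ℂ}
    (hX : IsSmoothProjective n X) (hpn : n ≤ p) (c : complexBetti X (2 * p))
    (hpp : IsOfHodgeType n X (2 * p) p p c) : c ∈ algebraicClasses X p := by
  rcases hpn.eq_or_lt with rfl | hlt
  · rcases Nat.eq_zero_or_pos n with rfl | hn
    · exact hodgeConjectureFor_codim_zero c
    · exact mem_algebraicClasses_of_degree_top hX hn c
  · rw [hpp.eq_zero_pp_of_lt hlt]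
    exact Submodule.zero_mem _

/-- **Item stmt-HodgeConjecture-1084 (`HardLefschetzReduction`) from the named fact
`nonempty_hardLefschetzNFold` in dimensions `≥ 3`.**  For `n < 2p` on a smooth projective `n`-fold,
HC in codimension `n - p` implies HC in codimension `p`: if `n ≤ p` this is
`linearSystemTorelli_mem_algebraicClasses_of_dim_le` (no fact); otherwise `p < n < 2p` forces
`n ≥ 3`, and a hard Lefschetz datum `Λ : HardLefschetzNFold n X` (Voisin I, Thm. 6.25, Rem. 6.27,
§7.1.2: `L^{2p-n}` is an isomorphism `H^{2n-2p}(X, ℚ) ≅ H^{2p}(X, ℚ)` of bidegree `(2p-n, 2p-n)`;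
Voisin II Prop. 9.20: `L` preserves algebraic classes) gives `c = L^{2p-n} c'` with `c'` rational of
type `(n-p, n-p)`, algebraic by hypothesis, hence `c` algebraic
(`HardLefschetzNFold.mem_algebraicClasses_of_lt`).  CONDITIONAL on the fact (not yet discharged).
[cite: VoisinHodgeI2002, Thm. 6.25, Rem. 6.27 and §7.1.2] [cite: KerrPearlstein2011, §3.1] -/
theorem linearSystemTorelli_hardLefschetzReduction_of_nonempty_hardLefschetzNFold
    (h : ∀ (n : ℕ) (X : SchemeOver ℂ), 3 ≤ n → nonempty_hardLefschetzNFold n X) :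
    Summit.HodgeConjecture.HodgeConjecture.Theses.LinearSystemTorelli.HardLefschetzReduction := by
  unfold Summit.HodgeConjecture.HodgeConjecture.Theses.LinearSystemTorelli.HardLefschetzReduction
  intro n p hnp X hX hyp c hc hpp
  by_cases hpn : n ≤ p
  · exact linearSystemTorelli_mem_algebraicClasses_of_dim_le hX hpn c hpp
  · exact (Classical.choice (h n X (by omega) hX)).mem_algebraicClasses_of_lt hnp hyp c hc hpp

/-- **Item stmt-HodgeConjecture-1084 (`HardLefschetzReduction`), unconditionally.** For `n < 2p`
on a smooth projective complex `n`-fold, the Hodge conjecture in codimension `n - p` implies the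
Hodge conjecture in codimension `p`: the conditional form
`linearSystemTorelli_hardLefschetzReduction_of_nonempty_hardLefschetzNFold` fed with the DISCHARGED
fact `nonempty_hardLefschetzNFold_holds` (file `Literature/…/HardLefschetzNFoldHolds`: the hard
Lefschetz datum of a rational complex multiple of the hyperplane-type class — Voisin I Thm. 6.25,
Rem. 6.27, §7.1.2; the rationality from `b₂(ℙᴺ) = 1`, the naturality of the restricted
Fubini–Study form and the rigidity of natural de Rham comparisons, file `HyperplaneClassRational`).
[cite: VoisinHodgeI2002, Thm. 6.25, Rem. 6.27 and §7.1.2] [cite: KerrPearlstein2011, §3.1] -/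
theorem linearSystemTorelli_hardLefschetzReduction_proof :
    Summit.HodgeConjecture.HodgeConjecture.Theses.LinearSystemTorelli.HardLefschetzReduction :=
  linearSystemTorelli_hardLefschetzReduction_of_nonempty_hardLefschetzNFold
    fun n X _ ↦ nonempty_hardLefschetzNFold_holds (n := n) (X := X)

end Summit.HodgeConjecture.HodgeConjecture.Theorems

end
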